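import Summits.BirchSwinnertonDyer.BirchSwinnertonDyer.Theorems.AlignedTransportAtTwoMainConjectureTransportAlignedAtTwoDeltaPosJacobian
import Summits.BirchSwinnertonDyer.Rank1Residual.F1Sign2.CopyAlignmentAtTwo
import HarnessLib

/-!
# Crux C1 `MainConjectureTransportAlignedAtTwo` (stmt-BirchSwinnertonDyer-22296), line `birth`, residual (R2) `stub_lamLawKilford` (Kilford stratum):
# the half-class Jacobi map KILLS `𝔪_f · H₁(X₀(N);ℤ)` — the Hecke half of the carrier row «`θ_D` kills `U^⊥`» (width seat att-p4 g17; `--supports 22296`)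

THEOREMS ONLY (no `def`, no `sorry`, no named fact). BSD is not proved by this; C1 is not closed by this.

One row of the kernel-letter carrier (`…KilfordKernelLetterOnPoints.ker_iff_ker_of_alignedAtTwo`, p690985) asks that the parametrisation on `2`-torsion
`θ_D : J₀(N)[2] → W[2]` kill `U^⊥` for `U = J₀(N)[𝔪_f]`; for a Hecke-self-adjoint perfect pairing `U^⊥ = 𝔪_f · J₀(N)[2]`. This file proves the
arithmetic half in the tree's own currency (`Λ = periodHomologyHecke N`, `D : ModularParametrizationData W N`, `𝔪_f = F1Sign2.modTwoHeckeIdeal D.f`):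
for every `t ∈ 𝔪_f` and `y ∈ Λ`, `D.jacobiMap [(t·y)/2] = O`. Reason: `𝔪_f = Ann(f) + 2𝕋`; for `s ∈ Ann(f)`, `(s·y)(f) = y(s f) = 0`; for `2a`,
`[(2a·y)/2] = [a·y] = 0` in `J₀(N)(ℂ) = V/Λ`.

* `jacobiMap_half_smul_eq_zero_of_mem_heckeAnnihilator`, `jacobiMap_half_smul_eq_zero_of_two_dvd`,
  **`jacobiMap_half_smul_eq_zero_of_mem_modTwoHeckeIdeal`**, and the coset form `jacobiMap_half_add_smul_eq`.

References: J. E. Cremona, Algorithms for modular elliptic curves (1997) §2.10 [CremonaAlgorithms1997]; H. Darmon, F. Diamond, R. Taylor (1995) §1.3, §1.7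
[DarmonDiamondTaylor1995].
-/

set_option autoImplicit false

noncomputable section

-- justification: the `Summit.BirchSwinnertonDyer.BirchSwinnertonDyer.…` path repeats a component (route-file convention)
set_option linter.dupNamespace false

open scoped MatrixGroups ModularForm Classical
open CongruenceSubgroup WeierstrassCurve
open Literature.NumberTheory.EllipticCurves Literature.NumberTheory.EllipticCurves.ModularForms
open Summit.BirchSwinnertonDyer.Rank1Residual.F1Sign2
open Summit.BirchSwinnertonDyer.BirchSwinnertonDyer.Theorems.AlignedTransportAtTwoDeltaPosJacobian

namespace Summit.BirchSwinnertonDyer.BirchSwinnertonDyer.Theorems.AlignedTransportAtTwoKilfordKernelLetterHecke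

variable {N : ℕ} [NeZero N] {W : WeierstrassCurve ℚ} (D : ModularParametrizationData W N)

/-- **The Jacobi map kills `Ann(f)`-multiples of half-classes**: for `s ∈ Ann_𝕋(f)` and `y ∈ Λ`, `D.jacobiMap [(s·y)/2] = u_W(c·y(s f)/2) = u_W(0) = O`.
[cite: CremonaAlgorithms1997, §2.10] -/
theorem jacobiMap_half_smul_eq_zero_of_mem_heckeAnnihilator {s : HeckeRing0 N 2} (hs : s ∈ heckeAnnihilator D.f)
    (y : periodHomologyHecke N) :
    D.jacobiMap (Submodule.Quotient.mk ((2 : ℂ)⁻¹ • ((s • y : periodHomologyHecke N) : Module.Dual ℂ (CuspForm (Gamma0 N) 2)))) = 0 := by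
  have hsf : HeckeRing0.toEnd N 2 s D.f = 0 := hs
  have h0 : ((s • y : periodHomologyHecke N) : Module.Dual ℂ (CuspForm (Gamma0 N) 2)) D.f = 0 := by
    rw [Submodule.coe_smul, HeckeRing0.smul_dual_apply, hsf, map_zero]
  rw [jacobiMap_half_eq, h0, mul_zero, zero_div, map_zero]

/-- **The Jacobi map kills `2𝕋`-multiples of half-classes**: `[(2a·y)/2] = [a·y] = 0` in `J₀(N)(ℂ) = V/Λ`. [cite: DarmonDiamondTaylor1995, §1.3] -/
theorem jacobiMap_half_smul_eq_zero_of_two_dvd {r : HeckeRing0 N 2} (hr : (2 : HeckeRing0 N 2) ∣ r) (y : periodHomologyHecke N) :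
    D.jacobiMap (Submodule.Quotient.mk ((2 : ℂ)⁻¹ • ((r • y : periodHomologyHecke N) : Module.Dual ℂ (CuspForm (Gamma0 N) 2)))) = 0 := by
  obtain ⟨a, rfl⟩ := hr
  have h2 : ((2 * a) • y : periodHomologyHecke N) = a • y + a • y := by rw [mul_smul, two_smul]
  have hhalf : (2 : ℂ)⁻¹ • (((2 * a) • y : periodHomologyHecke N) : Module.Dual ℂ (CuspForm (Gamma0 N) 2)) =
      ((a • y : periodHomologyHecke N) : Module.Dual ℂ (CuspForm (Gamma0 N) 2)) := by
    rw [h2, Submodule.coe_add, ← two_smul ℂ, smul_smul, inv_mul_cancel₀ (two_ne_zero' ℂ), one_smul]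
  rw [hhalf, (Submodule.Quotient.mk_eq_zero _).mpr (a • y).2, map_zero]

/-- **The Jacobi map on half-classes kills `𝔪_f · Λ`** (`𝔪_f = Ann(f) + 2𝕋 = F1Sign2.modTwoHeckeIdeal f`): for `t ∈ 𝔪_f` and `y ∈ Λ = H₁(X₀(N);ℤ)`,
`D.jacobiMap [(t·y)/2] = O`. With a Hecke-self-adjoint perfect pairing (`(J₀(N)[𝔪])^⊥ = 𝔪 J₀(N)[2]`) this is the row «`θ_D` kills `U^⊥`» of the kernel-letter
carrier. [cite: CremonaAlgorithms1997, §2.10] [cite: DarmonDiamondTaylor1995, §1.3 and §1.7] -/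
theorem jacobiMap_half_smul_eq_zero_of_mem_modTwoHeckeIdeal {t : HeckeRing0 N 2} (ht : t ∈ modTwoHeckeIdeal D.f)
    (y : periodHomologyHecke N) :
    D.jacobiMap (Submodule.Quotient.mk ((2 : ℂ)⁻¹ • ((t • y : periodHomologyHecke N) : Module.Dual ℂ (CuspForm (Gamma0 N) 2)))) = 0 := by
  obtain ⟨s, hs, r, hr, rfl⟩ := Submodule.mem_sup.mp ht
  have hr' : (2 : HeckeRing0 N 2) ∣ r := by
    rw [Ideal.mem_span_singleton'] at hr
    obtain ⟨a, rfl⟩ := hr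
    exact Dvd.intro_left a rfl
  rw [add_smul, Submodule.coe_add, smul_add, Submodule.Quotient.mk_add, map_add,
    jacobiMap_half_smul_eq_zero_of_mem_heckeAnnihilator D hs, jacobiMap_half_smul_eq_zero_of_two_dvd D hr', add_zero]

/-- **Coset form**: the half-class Jacobi map is constant on `𝔪_f`-cosets — `D.jacobiMap [(y + t·z)/2] = D.jacobiMap [y/2]` for `t ∈ 𝔪_f`.
[cite: CremonaAlgorithms1997, §2.10] -/
theorem jacobiMap_half_add_smul_eq {t : HeckeRing0 N 2} (ht : t ∈ modTwoHeckeIdeal D.f) (y z : periodHomologyHecke N) :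
    D.jacobiMap (Submodule.Quotient.mk ((2 : ℂ)⁻¹ • ((y + t • z : periodHomologyHecke N) : Module.Dual ℂ (CuspForm (Gamma0 N) 2)))) =
      D.jacobiMap (Submodule.Quotient.mk ((2 : ℂ)⁻¹ • (y : Module.Dual ℂ (CuspForm (Gamma0 N) 2)))) := by
  rw [Submodule.coe_add, smul_add, Submodule.Quotient.mk_add, map_add, jacobiMap_half_smul_eq_zero_of_mem_modTwoHeckeIdeal D ht, add_zero]

end Summit.BirchSwinnertonDyer.BirchSwinnertonDyer.Theorems.AlignedTransportAtTwoKilfordKernelLetterHecke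

end
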